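import Literature.LinearAlgebra.TensorNetworks.QTTLaplaceMulti
import Literature.Analysis.Matrix.DirichletSecondDifferenceEigen
import Literature.Combinatorics.SimpleGraph.PathSpectrum
import HarnessLib

/-!
# Tensor-product (separation-of-variables) diagonalisation of the `D`-dimensional Laplacian

Topic `Literature/LinearAlgebra/TensorNetworks`; namespace
`Literature.LinearAlgebra.TensorNetworks`.
Support file for the Kazeev–Khoromskij operator `laplaceMulti a Δ = Σ_k I ⊗ ⋯ ⊗ a_kΔ_k ⊗ ⋯ ⊗ I`
(`QTTLaplaceMulti.lean`, eq. (3)) and the Kronecker product of a family `kronPi`: the classical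
TENSOR PRODUCT ANALYSIS of Lynch–Rice–Thomas and the FAST POISSON SOLVER FRAMEWORK of
Golub–Van Loan §4.8.4, for `D` factors of one common size.

* `tensorPi x = ⊗_k x_k` (the vector `(i_k)_k ↦ ∏_k x_k(i_k)`), `kronPi_mulVec_tensorPi`
  (`(⊗A_k)(⊗x_k) = ⊗(A_k x_k)`), `kronPi_smul`, `kronPi_update_smul`, `kronPi_update_add`
  (multilinearity in one factor), `kronPi_diagonal`, `kronPi_transpose`,
  `kronPi_mul_kronPi_inv`, `isUnit_det_kronPi`, `kronPi_inv` (`(⊗V_k)⁻¹ = ⊗V_k⁻¹`).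
* `laplaceMulti_eq_sum_kronPi` (`Δ^{(D)} = Σ_k a_k · I ⊗ ⋯ ⊗ Δ_k ⊗ ⋯ ⊗ I`),
  `laplaceMulti_mulVec_tensorPi`, and the eigen-equation
  `laplaceMulti_mulVec_tensorPi_of_eigvec`:
  `Δ_k x_k = μ_k x_k (∀ k) ⇒ Δ^{(D)}(⊗x_k) = (Σ_k a_kμ_k)(⊗x_k)`.
* THE FAST EIGENVALUE DECOMPOSITION: if `Δ_k V_k = V_k diag(μ_k)` for every `k` then
  `laplaceMulti_mul_kronPi`: `Δ^{(D)} (⊗V_k) = (⊗V_k) diag(j ↦ Σ_k a_k μ_k(j_k))`; with the `V_k`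
  invertible, `kronPi_inv_mul_laplaceMulti_mul_kronPi`, `laplaceMulti_eq_kronPi_conj`,
  `charpoly_laplaceMulti` (`χ = ∏_j (X − Σ_k a_kμ_k(j_k))`), `det_laplaceMulti`, and — over a
  field, when no `Σ_k a_kμ_k(j_k)` vanishes — the EXACT SOLUTION FORMULA (2.5) of Lynch–Rice–Thomas
  `inv_laplaceMulti_eq_kronPi_conj`: `(Δ^{(D)})⁻¹ = (⊗V_k) diag((Σ_k a_kμ_k(j_k))⁻¹) (⊗V_k)⁻¹`,
  entrywise `inv_laplaceMulti_apply` ((2.6), 'the analog of the … Green's function').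
* THE MODEL PROBLEM (Dirichlet–Dirichlet in every direction, `Δ_k = Δ_DD = tridiag(−1,2,−1)` of
  size `N`, weights `a_k`, e.g. `a_k = h_k⁻²`): eigenvectors `⊗_k s(θ_{j_k})` (products of sine
  modes), eigenvalues `Σ_k a_k · 4 sin²(θ_{j_k}/2)`, `θ_j = (j+1)π/(N+1)`:
  `laplaceMultiDD_mulVec_tensorPi_pathMode`, `laplaceMultiDD_mul_kronPi_sineMatrix`,
  `kronPi_sineMatrix_inv` (`(⊗S)⁻¹ = (2/(N+1))^D ⊗Sᵀ`), `laplaceMultiDD_eq_sine_conj`,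
  `charpoly_laplaceMultiDD`, `det_laplaceMultiDD`, `laplaceMultiDD_eig_pos`, and the discrete
  Green's function of the box as a `D`-fold sine series: `inv_laplaceMultiDD_eq_sine_conj`,
  `inv_laplaceMultiDD_apply`.  The one-dimensional eigen-system of `Δ_DD` itself is the subject of
  `QTTLaplaceSpectrum.lean` (`dirichletEig`, `laplaceDD_mulVec_pathMode`,
  `laplaceDD_mul_sineMatrix`); this file re-derives the two lines it needs privately from
  `DirichletSecondDifferenceEigen` and `PathSpectrum` and writes the eigenvalue as `4 sin²(θ_j/2)`
  so as not to depend on that module.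
* TWO FACTORS in Mathlib's Kronecker notation (the tree's `kroneckerSum A B = A ⊗ₖ 1 + 1 ⊗ₖ B`):
  `kroneckerSum_diagonal`, `kroneckerSum_mul_kronecker` ((4.8.12)–(4.8.14) verbatim),
  `isUnit_det_kronecker_of_isUnit`, `kroneckerSum_eq_kronecker_conj`, `charpoly_kroneckerSum`,
  `det_kroneckerSum`, `inv_kroneckerSum_eq` ((2.5) verbatim:
  `(A ⊕ B)⁻¹ = (P ⊗ Q) diag((λ_i + μ_j)⁻¹) (P⁻¹ ⊗ Q⁻¹)`).  In the tree already: the open-grid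
  instance `adjMatrix_grid_eq_sine_conj` / `charpoly_adjMatrix_grid` (`PathSpectrum.lean`), the
  vector-level two-factor eigen-equation `kroneckerSum_mulVec_tensor` (`KroneckerSumExp.lean`), and
  the converse direction (eigenbases of `A`, `B` from one of `A ⊕ B`) in
  `KroneckerSumDiagonalizable.lean`; none of them is restated here.

Sources.
* [LynchRiceThomas1964] R. E. Lynch, J. R. Rice, D. H. Thomas, *Tensor product analysis of partial
  difference equations*, Bull. Amer. Math. Soc. 70 (1964) 378–384, §2: the Kronecker rules
  `(A⊗B)(C⊗D) = AC⊗BD`, `(A⊗B)⁻¹ = A⁻¹⊗B⁻¹` (p. 378), the five-point system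
  `(I ⊗ A + B ⊗ I)u = g` (2.4), `P⁻¹AP = Λ(A)`, `Q⁻¹BQ = Λ(B)`, the exact solution
  `u = {Q ⊗ P [I ⊗ Λ(A) + Λ(B) ⊗ I]⁻¹ Q⁻¹ ⊗ P⁻¹} g` (2.5), its entrywise form (2.6), and 'The method
  is easily extended to higher dimensions' (p. 381) — fetched open-access text, pp. 378–381.
* [GolubVanLoan2013] G. H. Golub, C. F. Van Loan, *Matrix Computations*, 4th ed., §4.8.4
  (`A = I_{n₂} ⊗ A₁ + A₂ ⊗ I_{n₁}` (4.8.12), fast eigenvalue decompositions `V⁻¹A₁V = D₁`,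
  `W⁻¹A₂W = D₂` (4.8.13)–(4.8.14), `ũ_{ij} = b̃_{ij}/(λ_i + μ_j)`, Algorithm 4.8.2) and §4.8.6 ('The
  Dirichlet–Dirichlet matrix': `V = DST(n)`, `λ_j = 4 sin²(jπ/(2(n+1)))`) — held text p0217, p0220.
* [KazeevKhoromskij2012] V. A. Kazeev, B. N. Khoromskij, SIAM J. Matrix Anal. Appl. 33 (2012),
  eq. (3) (the operator) and Rem. 0.6 (Kronecker products of families).

Orientation: for `D = 2` the operator `laplaceMulti a Δ` is `a₀Δ₀ ⊗ I + I ⊗ a₁Δ₁`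
(`reindex_laplaceMulti_two`), i.e. Lynch–Rice–Thomas' `I ⊗ A + B ⊗ I` with `A = a₁Δ₁`,
`B = a₀Δ₀`.  Honest scope: one common index type `ι` for all directions (as in
`QTTLaplaceMulti.lean`).  No new named facts; every declaration is proved.
-/

noncomputable section

namespace Literature.LinearAlgebra.TensorNetworks

open Matrix Finset Real
open Literature.Analysis.Matrix.DiscretePoisson
open Literature.Combinatorics.SimpleGraph

/-! ### Tensor products of vectors and the Kronecker product of a family -/

section Multilinear

variable {K : Type*} [CommRing K] {ι : Type*} {D : ℕ}

/-- THE TENSOR PRODUCT `⊗_k x_k` of a family of vectors: `(⊗_k x_k)((i_k)_k) = ∏_k x_k(i_k)`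
(for `D = 2` the vector `x₀ ⊗ x₁` of the five-point analysis).
[cite: LynchRiceThomas1964, §2 eq. (2.5)] [cite: KazeevKhoromskij2012, Rem. 0.6] -/
def tensorPi (x : Fin D → ι → K) : (Fin D → ι) → K := fun i => ∏ k, x k (i k)

/-- Definitional unfolding of `tensorPi`. [cite: KazeevKhoromskij2012, Rem. 0.6] -/
@[simp] theorem tensorPi_apply (x : Fin D → ι → K) (i : Fin D → ι) :
    tensorPi x i = ∏ k, x k (i k) := rfl

/-- Replacing one factor: `∏_r (x with x_k := y)_r(i_r) = y(i_k) ∏_{r ≠ k} x_r(i_r)`. [folklore] -/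
private theorem prod_update_vec (x : Fin D → ι → K) (k : Fin D) (y : ι → K) (i : Fin D → ι) :
    ∏ r, Function.update x k y r (i r) = y (i k) * ∏ r ∈ univ.erase k, x r (i r) := by
  rw [← Finset.mul_prod_erase _ _ (Finset.mem_univ k), Function.update_self]
  congr 1
  exact Finset.prod_congr rfl fun r hr => by rw [Function.update_of_ne (Finset.ne_of_mem_erase hr)]

/-- The same for a family of matrices. [folklore] -/
private theorem prod_update_mat (A : Fin D → Matrix ι ι K) (k : Fin D) (B : Matrix ι ι K)
    (i j : Fin D → ι) :
    ∏ r, Function.update A k B r (i r) (j r) =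
      B (i k) (j k) * ∏ r ∈ univ.erase k, A r (i r) (j r) := by
  rw [← Finset.mul_prod_erase _ _ (Finset.mem_univ k), Function.update_self]
  congr 1
  exact Finset.prod_congr rfl fun r hr => by rw [Function.update_of_ne (Finset.ne_of_mem_erase hr)]

/-- Scalars pull out of every factor: `⊗_k (c_k A_k) = (∏_k c_k) ⊗_k A_k`.
[cite: LynchRiceThomas1964, §2 (p. 378)] -/
theorem kronPi_smul (c : Fin D → K) (A : Fin D → Matrix ι ι K) :
    kronPi (fun k => c k • A k) = (∏ k, c k) • kronPi A := by
  ext i j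
  simp only [kronPi_apply, Matrix.smul_apply, smul_eq_mul, Finset.prod_mul_distrib]

/-- Linearity in one factor (scalars): `⋯ ⊗ (cB) ⊗ ⋯ = c (⋯ ⊗ B ⊗ ⋯)`.
[cite: LynchRiceThomas1964, §2 (p. 378)] -/
theorem kronPi_update_smul (A : Fin D → Matrix ι ι K) (k : Fin D) (c : K) (B : Matrix ι ι K) :
    kronPi (Function.update A k (c • B)) = c • kronPi (Function.update A k B) := by
  ext i j
  simp only [kronPi_apply, Matrix.smul_apply, smul_eq_mul, prod_update_mat, mul_assoc]

/-- Linearity in one factor (sums): `⋯ ⊗ (B + C) ⊗ ⋯ = (⋯ ⊗ B ⊗ ⋯) + (⋯ ⊗ C ⊗ ⋯)`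
('`(A+B)⊗C = A⊗C + B⊗C`, `A⊗(B+C) = A⊗B + A⊗C`').
[cite: LynchRiceThomas1964, §2 (p. 378)] -/
theorem kronPi_update_add (A : Fin D → Matrix ι ι K) (k : Fin D) (B C : Matrix ι ι K) :
    kronPi (Function.update A k (B + C)) =
      kronPi (Function.update A k B) + kronPi (Function.update A k C) := by
  ext i j
  simp only [kronPi_apply, Matrix.add_apply, prod_update_mat, add_mul]

/-- `(⊗_k A_k)ᵀ = ⊗_k A_kᵀ`. [cite: LynchRiceThomas1964, §2 (p. 380, `P⁻¹ = Pᵀ`, `Q⁻¹ = Qᵀ`)] -/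
theorem kronPi_transpose (A : Fin D → Matrix ι ι K) : (kronPi A)ᵀ = kronPi fun k => (A k)ᵀ := by
  ext i j
  simp only [transpose_apply, kronPi_apply]

end Multilinear

section Action

variable {K : Type*} [CommRing K] {ι : Type*} [Fintype ι] {D : ℕ}

/-- `(⊗_k A_k)(⊗_k x_k) = ⊗_k (A_k x_k)` (the mixed-product rule on vectors).
[cite: LynchRiceThomas1964, §2 (p. 378, `(A⊗B)(C⊗D) = AC⊗BD`)] -/
theorem kronPi_mulVec_tensorPi (A : Fin D → Matrix ι ι K) (x : Fin D → ι → K) :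
    kronPi A *ᵥ tensorPi x = tensorPi fun k => A k *ᵥ x k := by
  funext i
  simp only [Matrix.mulVec, dotProduct, kronPi_apply, tensorPi_apply, ← Finset.prod_mul_distrib]
  exact (Fintype.prod_sum fun k (y : ι) => A k (i k) y * x k y).symm

/-- Tensor products of eigenvectors are eigenvectors of `⊗_k A_k`, eigenvalue `∏_k μ_k`.
[cite: LynchRiceThomas1964, §2 (p. 378)] -/
theorem kronPi_mulVec_tensorPi_of_eigvec {A : Fin D → Matrix ι ι K} {x : Fin D → ι → K}
    {μ : Fin D → K} (h : ∀ k, A k *ᵥ x k = μ k • x k) :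
    kronPi A *ᵥ tensorPi x = (∏ k, μ k) • tensorPi x := by
  rw [kronPi_mulVec_tensorPi]
  funext i
  simp only [tensorPi_apply, h, Pi.smul_apply, smul_eq_mul, Finset.prod_mul_distrib]

end Action

section Diagonal

variable {K : Type*} [CommRing K] {ι : Type*} [DecidableEq ι] {D : ℕ}

/-- A Kronecker product of diagonal matrices is diagonal: `⊗_k diag(d_k) = diag(j ↦ ∏_k d_k(j_k))`.
[cite: LynchRiceThomas1964, §2 eq. (2.5) (`I ⊗ Λ(A) + Λ(B) ⊗ I` is diagonal)] -/
theorem kronPi_diagonal (d : Fin D → ι → K) :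
    kronPi (fun k => diagonal (d k)) = diagonal fun j : Fin D → ι => ∏ k, d k (j k) := by
  ext i j
  simp only [kronPi_apply, diagonal_apply]
  by_cases h : i = j
  · subst h
    simp
  · rw [if_neg h]
    obtain ⟨r, hr⟩ := Function.ne_iff.mp h
    exact Finset.prod_eq_zero (Finset.mem_univ r) (if_neg hr)

/-- [folklore] `I ⊗ ⋯ ⊗ diag(d) ⊗ ⋯ ⊗ I = diag(j ↦ d(j_k))` (slot `k`). -/
private theorem kronPi_update_one_diagonal (k : Fin D) (d : ι → K) :
    kronPi (Function.update (fun _ : Fin D => (1 : Matrix ι ι K)) k (diagonal d)) =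
      diagonal fun j : Fin D → ι => d (j k) := by
  have h3 : Function.update (fun _ : Fin D => (1 : Matrix ι ι K)) k (diagonal d) =
      fun r => diagonal fun i => if r = k then d i else 1 := by
    funext r
    by_cases h : r = k
    · subst h
      simp
    · simp [h]
  rw [h3, kronPi_diagonal]
  congr 1
  funext j
  simp [Finset.prod_ite_eq']

/-! ### The operator (3) as a sum of one-factor Kronecker products; its action on tensors -/

/-- `Δ^{(D)} = Σ_k a_k · (I ⊗ ⋯ ⊗ Δ_k ⊗ ⋯ ⊗ I)` (`Δ_k` in slot `k`).
[cite: KazeevKhoromskij2012, eq. (3)] [cite: GolubVanLoan2013, §4.8.4 eq. (4.8.12)] -/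
theorem laplaceMulti_eq_sum_kronPi (a : Fin D → K) (Δ : Fin D → Matrix ι ι K) :
    laplaceMulti a Δ =
      ∑ k, a k • kronPi (Function.update (fun _ : Fin D => (1 : Matrix ι ι K)) k (Δ k)) := by
  unfold laplaceMulti laplaceLike
  refine Finset.sum_congr rfl fun k _ => ?_
  rw [← kronPi_update_smul]
  congr 1
  funext r
  simp only [Function.update_apply]
  by_cases h : r = k
  · subst h
    simp
  · simp [h]

end Diagonal

section Spectral

variable {K : Type*} [CommRing K] {ι : Type*} [Fintype ι] [DecidableEq ι] {D : ℕ}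

/-- `(⊗_k V_k)(⊗_k V_k⁻¹) = I` for invertible factors.
[cite: LynchRiceThomas1964, §2 (p. 378, `(A⊗B)⁻¹ = A⁻¹⊗B⁻¹`)] -/
theorem kronPi_mul_kronPi_inv {V : Fin D → Matrix ι ι K} (hV : ∀ k, IsUnit (V k).det) :
    kronPi V * kronPi (fun k => (V k)⁻¹) = 1 := by
  rw [kronPi_mul_kronPi]
  have h : (fun r => V r * (V r)⁻¹) = fun _ : Fin D => (1 : Matrix ι ι K) :=
    funext fun r => Matrix.mul_nonsing_inv _ (hV r)
  rw [h, kronPi_one]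

/-- A Kronecker product of invertible matrices is invertible.
[cite: LynchRiceThomas1964, §2 (p. 378, `(A⊗B)⁻¹ = A⁻¹⊗B⁻¹`)] -/
theorem isUnit_det_kronPi {V : Fin D → Matrix ι ι K} (hV : ∀ k, IsUnit (V k).det) :
    IsUnit (kronPi V).det :=
  Matrix.isUnit_det_of_right_inverse (kronPi_mul_kronPi_inv hV)

/-- `(⊗_k V_k)⁻¹ = ⊗_k V_k⁻¹`. [cite: LynchRiceThomas1964, §2 (p. 378, `(A⊗B)⁻¹ = A⁻¹⊗B⁻¹`)] -/
theorem kronPi_inv {V : Fin D → Matrix ι ι K} (hV : ∀ k, IsUnit (V k).det) :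
    (kronPi V)⁻¹ = kronPi fun k => (V k)⁻¹ :=
  Matrix.inv_eq_right_inv (kronPi_mul_kronPi_inv hV)

/-- Action on a tensor: `Δ^{(D)}(⊗_r x_r) = Σ_k a_k · x₀ ⊗ ⋯ ⊗ (Δ_k x_k) ⊗ ⋯ ⊗ x_{D−1}`.
[cite: LynchRiceThomas1964, §2 eq. (2.4)] [cite: GolubVanLoan2013, §4.8.4 eq. (4.8.12)] -/
theorem laplaceMulti_mulVec_tensorPi (a : Fin D → K) (Δ : Fin D → Matrix ι ι K)
    (x : Fin D → ι → K) :
    laplaceMulti a Δ *ᵥ tensorPi x =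
      ∑ k, a k • tensorPi (Function.update x k (Δ k *ᵥ x k)) := by
  rw [laplaceMulti_eq_sum_kronPi, Matrix.sum_mulVec]
  refine Finset.sum_congr rfl fun k _ => ?_
  rw [Matrix.smul_mulVec, kronPi_mulVec_tensorPi]
  congr 1
  congr 1
  funext r
  by_cases h : r = k
  · subst h
    simp
  · simp [Function.update_of_ne h]

/-- **Separation of variables.** If `Δ_k x_k = μ_k x_k` for every direction `k`, then
`Δ^{(D)} (⊗_k x_k) = (Σ_k a_k μ_k) · ⊗_k x_k`: tensor products of one-dimensional eigenvectors
are eigenvectors, the eigenvalues ADD ('`ũ_{ij} = b̃_{ij}/(λ_i + μ_j)`').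
[cite: GolubVanLoan2013, §4.8.4 eqs. (4.8.12)–(4.8.14)] [cite: LynchRiceThomas1964, §2 eq. (2.5)] -/
theorem laplaceMulti_mulVec_tensorPi_of_eigvec (a : Fin D → K) {Δ : Fin D → Matrix ι ι K}
    {x : Fin D → ι → K} {μ : Fin D → K} (h : ∀ k, Δ k *ᵥ x k = μ k • x k) :
    laplaceMulti a Δ *ᵥ tensorPi x = (∑ k, a k * μ k) • tensorPi x := by
  rw [laplaceMulti_mulVec_tensorPi, Finset.sum_smul]
  refine Finset.sum_congr rfl fun k _ => ?_
  rw [h k, ← smul_smul]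
  congr 1
  funext i
  rw [Pi.smul_apply, smul_eq_mul, tensorPi_apply, tensorPi_apply, prod_update_vec,
    ← Finset.mul_prod_erase _ _ (Finset.mem_univ k), Pi.smul_apply, smul_eq_mul, mul_assoc]

/-! ### The fast eigenvalue decomposition (4.8.13)–(4.8.14) in `D` dimensions -/

/-- **Fast eigenvalue decomposition of `Δ^{(D)}`.** If `Δ_k V_k = V_k diag(μ_k)` in every direction,
then `Δ^{(D)} (⊗_k V_k) = (⊗_k V_k) · diag(j ↦ Σ_k a_k μ_k(j_k))` — the columns of `⊗_k V_k`
(tensor products of columns) are eigenvectors with eigenvalues the weighted sums.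
[cite: GolubVanLoan2013, §4.8.4 eqs. (4.8.13)–(4.8.14)] [cite: LynchRiceThomas1964, §2 eq. (2.5)] -/
theorem laplaceMulti_mul_kronPi (a : Fin D → K) {Δ V : Fin D → Matrix ι ι K} {μ : Fin D → ι → K}
    (hV : ∀ k, Δ k * V k = V k * diagonal (μ k)) :
    laplaceMulti a Δ * kronPi V = kronPi V * diagonal fun j => ∑ k, a k * μ k (j k) := by
  have key : ∀ k,
      kronPi (Function.update (fun _ : Fin D => (1 : Matrix ι ι K)) k (Δ k)) * kronPi V =
        kronPi V * diagonal fun j : Fin D → ι => μ k (j k) := by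
    intro k
    rw [kronPi_mul_kronPi]
    have h2 :
        (fun r => Function.update (fun _ : Fin D => (1 : Matrix ι ι K)) k (Δ k) r * V r) =
          fun r =>
            V r * Function.update (fun _ : Fin D => (1 : Matrix ι ι K)) k (diagonal (μ k)) r := by
      funext r
      by_cases h : r = k
      · subst h
        simp [hV]
      · simp [Function.update_of_ne h]
    rw [h2, ← kronPi_mul_kronPi, kronPi_update_one_diagonal]
  rw [laplaceMulti_eq_sum_kronPi, Finset.sum_mul]
  simp_rw [Matrix.smul_mul, key, ← Matrix.mul_smul, ← Finset.mul_sum]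
  congr 1
  ext i j
  simp only [Matrix.sum_apply, Matrix.smul_apply, smul_eq_mul, diagonal_apply]
  by_cases h : i = j
  · subst h
    simp
  · simp [h]

/-- `(⊗V_k)⁻¹ Δ^{(D)} (⊗V_k) = diag(j ↦ Σ_k a_k μ_k(j_k))` ('`V⁻¹A₁V = D₁`, `W⁻¹A₂W = D₂`'
combined).
[cite: GolubVanLoan2013, §4.8.4 eqs. (4.8.13)–(4.8.14)] [cite: LynchRiceThomas1964, §2 eq. (2.5)] -/
theorem kronPi_inv_mul_laplaceMulti_mul_kronPi (a : Fin D → K) {Δ V : Fin D → Matrix ι ι K}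
    {μ : Fin D → ι → K} (hV : ∀ k, Δ k * V k = V k * diagonal (μ k))
    (hdet : ∀ k, IsUnit (V k).det) :
    (kronPi V)⁻¹ * laplaceMulti a Δ * kronPi V = diagonal fun j => ∑ k, a k * μ k (j k) := by
  rw [Matrix.mul_assoc, laplaceMulti_mul_kronPi a hV, ← Matrix.mul_assoc,
    Matrix.nonsing_inv_mul _ (isUnit_det_kronPi hdet), Matrix.one_mul]

/-- Similarity form: `Δ^{(D)} = (⊗V_k) · diag(j ↦ Σ_k a_k μ_k(j_k)) · (⊗V_k)⁻¹`.
[cite: GolubVanLoan2013, §4.8.4 eqs. (4.8.13)–(4.8.14)] [cite: LynchRiceThomas1964, §2 eq. (2.5)] -/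
theorem laplaceMulti_eq_kronPi_conj (a : Fin D → K) {Δ V : Fin D → Matrix ι ι K}
    {μ : Fin D → ι → K} (hV : ∀ k, Δ k * V k = V k * diagonal (μ k))
    (hdet : ∀ k, IsUnit (V k).det) :
    laplaceMulti a Δ = kronPi V * diagonal (fun j => ∑ k, a k * μ k (j k)) * (kronPi V)⁻¹ := by
  rw [← laplaceMulti_mul_kronPi a hV,
    Matrix.mul_nonsing_inv_cancel_right _ _ (isUnit_det_kronPi hdet)]

/-- **The spectrum of `Δ^{(D)}`**: `χ(X) = ∏_{j} (X − Σ_k a_k μ_k(j_k))`, the product over all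
multi-indices `j = (j_k)_k` — all `|ι|^D` sums of one-dimensional eigenvalues, with multiplicity.
[cite: LynchRiceThomas1964, §2 eqs. (2.5)–(2.6)]
[cite: GolubVanLoan2013, §4.8.4 eqs. (4.8.13)–(4.8.14)] -/
theorem charpoly_laplaceMulti (a : Fin D → K) {Δ V : Fin D → Matrix ι ι K} {μ : Fin D → ι → K}
    (hV : ∀ k, Δ k * V k = V k * diagonal (μ k)) (hdet : ∀ k, IsUnit (V k).det) :
    (laplaceMulti a Δ).charpoly =
      ∏ j : Fin D → ι, (Polynomial.X - Polynomial.C (∑ k, a k * μ k (j k))) := by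
  have hS : IsUnit (kronPi V) := (Matrix.isUnit_iff_isUnit_det _).2 (isUnit_det_kronPi hdet)
  set U : (Matrix (Fin D → ι) (Fin D → ι) K)ˣ := hS.unit with hUdef
  have hUval : (U : Matrix (Fin D → ι) (Fin D → ι) K) = kronPi V := hS.unit_spec
  have key : laplaceMulti a Δ = U.val * diagonal (fun j => ∑ k, a k * μ k (j k)) * U.val⁻¹ := by
    rw [hUval]
    exact laplaceMulti_eq_kronPi_conj a hV hdet
  rw [key, Matrix.charpoly_units_conj, Matrix.charpoly_diagonal]

/-- `det Δ^{(D)} = ∏_j Σ_k a_k μ_k(j_k)`.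
[cite: LynchRiceThomas1964, §2 eq. (2.5)] [cite: GolubVanLoan2013, §4.8.4 eqs. (4.8.13)–(4.8.14)] -/
theorem det_laplaceMulti (a : Fin D → K) {Δ V : Fin D → Matrix ι ι K} {μ : Fin D → ι → K}
    (hV : ∀ k, Δ k * V k = V k * diagonal (μ k)) (hdet : ∀ k, IsUnit (V k).det) :
    (laplaceMulti a Δ).det = ∏ j : Fin D → ι, ∑ k, a k * μ k (j k) := by
  rw [laplaceMulti_eq_kronPi_conj a hV hdet,
    Matrix.det_conj ((Matrix.isUnit_iff_isUnit_det _).2 (isUnit_det_kronPi hdet)), det_diagonal]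

end Spectral

/-! ### The exact solution `u = (⊗V)[Σ…]⁻¹(⊗V⁻¹) g` (2.5) -/

section Solve

variable {K : Type*} [Field K] {ι : Type*} [Fintype ι] [DecidableEq ι] {D : ℕ}

/-- **The tensor-product solution formula** (2.5): if `Δ_k V_k = V_k diag(μ_k)` with invertible
`V_k` and no sum `Σ_k a_k μ_k(j_k)` vanishes, then
`(Δ^{(D)})⁻¹ = (⊗_k V_k) · diag((Σ_k a_k μ_k(j_k))⁻¹) · (⊗_k V_k)⁻¹`
('`u = {Q ⊗ P [I ⊗ Λ(A) + Λ(B) ⊗ I]⁻¹ Q⁻¹ ⊗ P⁻¹} g` … the matrix on the right side of (2.5) is the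
inverse of `L`').
[cite: LynchRiceThomas1964, §2 eq. (2.5)] [cite: GolubVanLoan2013, §4.8.4 Algorithm 4.8.2] -/
theorem inv_laplaceMulti_eq_kronPi_conj (a : Fin D → K) {Δ V : Fin D → Matrix ι ι K}
    {μ : Fin D → ι → K} (hV : ∀ k, Δ k * V k = V k * diagonal (μ k))
    (hdet : ∀ k, IsUnit (V k).det) (hne : ∀ j : Fin D → ι, ∑ k, a k * μ k (j k) ≠ 0) :
    (laplaceMulti a Δ)⁻¹ =
      kronPi V * diagonal (fun j => (∑ k, a k * μ k (j k))⁻¹) * (kronPi V)⁻¹ := by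
  have hP := isUnit_det_kronPi hdet
  have hD : diagonal (fun j : Fin D → ι => ∑ k, a k * μ k (j k)) *
      diagonal (fun j => (∑ k, a k * μ k (j k))⁻¹) = 1 := by
    rw [diagonal_mul_diagonal, ← diagonal_one]
    congr 1
    funext j
    exact mul_inv_cancel₀ (hne j)
  apply Matrix.inv_eq_right_inv
  rw [laplaceMulti_eq_kronPi_conj a hV hdet]
  calc kronPi V * diagonal (fun j => ∑ k, a k * μ k (j k)) * (kronPi V)⁻¹ *
        (kronPi V * diagonal (fun j => (∑ k, a k * μ k (j k))⁻¹) * (kronPi V)⁻¹)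
      = kronPi V * (diagonal (fun j => ∑ k, a k * μ k (j k)) * ((kronPi V)⁻¹ * kronPi V) *
          diagonal (fun j => (∑ k, a k * μ k (j k))⁻¹)) * (kronPi V)⁻¹ := by
        simp only [Matrix.mul_assoc]
    _ = 1 := by
        rw [Matrix.nonsing_inv_mul _ hP, Matrix.mul_one, hD, Matrix.mul_one,
          Matrix.mul_nonsing_inv _ hP]

/-- **Entrywise** (2.6):
`(Δ^{(D)})⁻¹(α, β) = Σ_j (∏_k V_k(α_k, j_k)) (Σ_k a_kμ_k(j_k))⁻¹ (∏_k V_k⁻¹(j_k, β_k))`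
('`u_α = Σ_β p_{αβ} Σ_k [λ_β(A) + λ_k(B)]⁻¹ q_{ak} Σ Σ p̄ q̄ g`': the discrete Green's function).
[cite: LynchRiceThomas1964, §2 eq. (2.6)] -/
theorem inv_laplaceMulti_apply (a : Fin D → K) {Δ V : Fin D → Matrix ι ι K} {μ : Fin D → ι → K}
    (hV : ∀ k, Δ k * V k = V k * diagonal (μ k)) (hdet : ∀ k, IsUnit (V k).det)
    (hne : ∀ j : Fin D → ι, ∑ k, a k * μ k (j k) ≠ 0) (α β : Fin D → ι) :
    (laplaceMulti a Δ)⁻¹ α β =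
      ∑ j : Fin D → ι, (∏ k, V k (α k) (j k)) * (∑ k, a k * μ k (j k))⁻¹ *
        ∏ k, (V k)⁻¹ (j k) (β k) := by
  rw [inv_laplaceMulti_eq_kronPi_conj a hV hdet hne, kronPi_inv hdet, Matrix.mul_apply]
  refine Finset.sum_congr rfl fun j _ => ?_
  rw [mul_diagonal, kronPi_apply, kronPi_apply]

end Solve

/-! ### Two factors in Mathlib's Kronecker notation: `A ⊕ B = A ⊗ I + I ⊗ B` -/

section TwoFactors

open scoped Kronecker
open Literature.Analysis.Matrix.KroneckerSum (kroneckerSum)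

variable {K : Type*} [CommRing K] {m n : Type*} [Fintype m] [DecidableEq m] [Fintype n]
  [DecidableEq n]

omit [Fintype m] [Fintype n] in
/-- `diag(λ) ⊕ diag(μ) = diag((i,j) ↦ λ_i + μ_j)` ('`I ⊗ Λ(A) + Λ(B) ⊗ I`' is diagonal).
[cite: LynchRiceThomas1964, §2 eq. (2.5)] -/
theorem kroneckerSum_diagonal (lam : m → K) (mu : n → K) :
    kroneckerSum (diagonal lam) (diagonal mu) = diagonal fun ij : m × n => lam ij.1 + mu ij.2 := by
  unfold kroneckerSum
  rw [← diagonal_one, ← diagonal_one, diagonal_kronecker_diagonal, diagonal_kronecker_diagonal,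
    diagonal_add]
  simp

/-- **The two-dimensional fast eigenvalue decomposition** (4.8.12)–(4.8.14): if `A P = P diag(λ)`
and `B Q = Q diag(μ)` then `(A ⊗ I + I ⊗ B)(P ⊗ Q) = (P ⊗ Q) diag((i,j) ↦ λ_i + μ_j)`.
[cite: GolubVanLoan2013, §4.8.4 eqs. (4.8.12)–(4.8.14)]
[cite: LynchRiceThomas1964, §2 eqs. (2.4)–(2.5)] -/
theorem kroneckerSum_mul_kronecker {A P : Matrix m m K} {B Q : Matrix n n K} {lam : m → K}
    {mu : n → K} (hA : A * P = P * diagonal lam) (hB : B * Q = Q * diagonal mu) :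
    kroneckerSum A B * P ⊗ₖ Q = P ⊗ₖ Q * diagonal fun ij : m × n => lam ij.1 + mu ij.2 := by
  rw [← kroneckerSum_diagonal]
  unfold kroneckerSum
  rw [Matrix.add_mul, Matrix.mul_add, ← mul_kronecker_mul, ← mul_kronecker_mul,
    ← mul_kronecker_mul, ← mul_kronecker_mul, hA, hB, Matrix.one_mul, Matrix.one_mul,
    Matrix.mul_one, Matrix.mul_one]

/-- `P ⊗ Q` is invertible when `P` and `Q` are. [cite: LynchRiceThomas1964, §2 (p. 378)] -/
theorem isUnit_det_kronecker_of_isUnit {P : Matrix m m K} {Q : Matrix n n K} (hP : IsUnit P.det)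
    (hQ : IsUnit Q.det) : IsUnit (P ⊗ₖ Q).det := by
  rw [det_kronecker]
  exact (hP.pow _).mul (hQ.pow _)

/-- Similarity form: `A ⊕ B = (P ⊗ Q) diag(λ_i + μ_j) (P ⊗ Q)⁻¹`.
[cite: GolubVanLoan2013, §4.8.4 eqs. (4.8.12)–(4.8.14)] [cite: LynchRiceThomas1964, §2 eq. (2.5)] -/
theorem kroneckerSum_eq_kronecker_conj {A P : Matrix m m K} {B Q : Matrix n n K} {lam : m → K}
    {mu : n → K} (hA : A * P = P * diagonal lam) (hB : B * Q = Q * diagonal mu) (hP : IsUnit P.det)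
    (hQ : IsUnit Q.det) :
    kroneckerSum A B = P ⊗ₖ Q * diagonal (fun ij : m × n => lam ij.1 + mu ij.2) * (P ⊗ₖ Q)⁻¹ := by
  rw [← kroneckerSum_mul_kronecker hA hB,
    Matrix.mul_nonsing_inv_cancel_right _ _ (isUnit_det_kronecker_of_isUnit hP hQ)]

/-- **Spectrum of a Kronecker sum with eigenbases**: `χ_{A ⊕ B}(X) = ∏_{(i,j)} (X − (λ_i + μ_j))`.
[cite: LynchRiceThomas1964, §2 eqs. (2.5)–(2.6)]
[cite: GolubVanLoan2013, §4.8.4 eqs. (4.8.13)–(4.8.14)] -/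
theorem charpoly_kroneckerSum {A P : Matrix m m K} {B Q : Matrix n n K} {lam : m → K} {mu : n → K}
    (hA : A * P = P * diagonal lam) (hB : B * Q = Q * diagonal mu) (hP : IsUnit P.det)
    (hQ : IsUnit Q.det) :
    (kroneckerSum A B).charpoly =
      ∏ ij : m × n, (Polynomial.X - Polynomial.C (lam ij.1 + mu ij.2)) := by
  have hS : IsUnit (P ⊗ₖ Q) :=
    (Matrix.isUnit_iff_isUnit_det _).2 (isUnit_det_kronecker_of_isUnit hP hQ)
  set U : (Matrix (m × n) (m × n) K)ˣ := hS.unit with hUdef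
  have hUval : (U : Matrix (m × n) (m × n) K) = P ⊗ₖ Q := hS.unit_spec
  have key :
      kroneckerSum A B = U.val * diagonal (fun ij : m × n => lam ij.1 + mu ij.2) * U.val⁻¹ := by
    rw [hUval]
    exact kroneckerSum_eq_kronecker_conj hA hB hP hQ
  rw [key, Matrix.charpoly_units_conj, Matrix.charpoly_diagonal]

/-- `det (A ⊕ B) = ∏_{(i,j)} (λ_i + μ_j)`.
[cite: LynchRiceThomas1964, §2 eq. (2.5)] [cite: GolubVanLoan2013, §4.8.4 eqs. (4.8.13)–(4.8.14)] -/
theorem det_kroneckerSum {A P : Matrix m m K} {B Q : Matrix n n K} {lam : m → K} {mu : n → K}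
    (hA : A * P = P * diagonal lam) (hB : B * Q = Q * diagonal mu) (hP : IsUnit P.det)
    (hQ : IsUnit Q.det) :
    (kroneckerSum A B).det = ∏ ij : m × n, (lam ij.1 + mu ij.2) := by
  rw [kroneckerSum_eq_kronecker_conj hA hB hP hQ,
    Matrix.det_conj ((Matrix.isUnit_iff_isUnit_det _).2 (isUnit_det_kronecker_of_isUnit hP hQ)),
    det_diagonal]

end TwoFactors

section TwoFactorsSolve

open scoped Kronecker
open Literature.Analysis.Matrix.KroneckerSum (kroneckerSum)

variable {K : Type*} [Field K] {m n : Type*} [Fintype m] [DecidableEq m] [Fintype n]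
  [DecidableEq n]

/-- **Lynch–Rice–Thomas (2.5) verbatim** (`u = {Q ⊗ P [I ⊗ Λ(A) + Λ(B) ⊗ I]⁻¹ Q⁻¹ ⊗ P⁻¹} g`):
`(A ⊕ B)⁻¹ = (P ⊗ Q) · diag((λ_i + μ_j)⁻¹) · (P⁻¹ ⊗ Q⁻¹)` when no `λ_i + μ_j` vanishes ('For this
to be well-defined, no eigenvalue of `A₁` can be the negative of an eigenvalue of `A₂`').
[cite: LynchRiceThomas1964, §2 eq. (2.5)] [cite: GolubVanLoan2013, §4.8.4 Algorithm 4.8.2] -/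
theorem inv_kroneckerSum_eq {A P : Matrix m m K} {B Q : Matrix n n K} {lam : m → K} {mu : n → K}
    (hA : A * P = P * diagonal lam) (hB : B * Q = Q * diagonal mu) (hP : IsUnit P.det)
    (hQ : IsUnit Q.det) (hne : ∀ i j, lam i + mu j ≠ 0) :
    (kroneckerSum A B)⁻¹ =
      P ⊗ₖ Q * diagonal (fun ij : m × n => (lam ij.1 + mu ij.2)⁻¹) * (P⁻¹ ⊗ₖ Q⁻¹) := by
  have hPQ := isUnit_det_kronecker_of_isUnit hP hQ
  have hD : diagonal (fun ij : m × n => lam ij.1 + mu ij.2) *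
      diagonal (fun ij : m × n => (lam ij.1 + mu ij.2)⁻¹) = 1 := by
    rw [diagonal_mul_diagonal, ← diagonal_one]
    congr 1
    funext ij
    exact mul_inv_cancel₀ (hne ij.1 ij.2)
  rw [← Matrix.inv_kronecker]
  apply Matrix.inv_eq_right_inv
  rw [kroneckerSum_eq_kronecker_conj hA hB hP hQ]
  calc P ⊗ₖ Q * diagonal (fun ij : m × n => lam ij.1 + mu ij.2) * (P ⊗ₖ Q)⁻¹ *
        (P ⊗ₖ Q * diagonal (fun ij : m × n => (lam ij.1 + mu ij.2)⁻¹) * (P ⊗ₖ Q)⁻¹)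
      = P ⊗ₖ Q * (diagonal (fun ij : m × n => lam ij.1 + mu ij.2) * ((P ⊗ₖ Q)⁻¹ * P ⊗ₖ Q) *
          diagonal (fun ij : m × n => (lam ij.1 + mu ij.2)⁻¹)) * (P ⊗ₖ Q)⁻¹ := by
        simp only [Matrix.mul_assoc]
    _ = 1 := by
        rw [Matrix.nonsing_inv_mul _ hPQ, Matrix.mul_one, hD, Matrix.mul_one,
          Matrix.mul_nonsing_inv _ hPQ]

end TwoFactorsSolve

/-! ### The model problem: Dirichlet–Dirichlet in every direction -/

section Dirichlet

variable {N D : ℕ}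

/-- `Δ_DD = T_N^{(DD)}` (bridge to `DirichletSecondDifferenceEigen`; the public statement is
`laplaceDD_eq_dirichletT` of `QTTLaplaceSpectrum.lean`, not imported here).
[cite: GolubVanLoan2013, §4.8.3 eq. (4.8.7)] -/
private theorem laplaceDD_eq_dirichletT_aux : laplaceDD ℝ N = dirichletT N := by
  ext m n
  simp only [laplaceDD, dirichletT, Matrix.of_apply]
  split_ifs <;> first | rfl | (exfalso; omega)

/-- The GVL sine vector at the GVL angle is the path mode (bridge to `PathSpectrum`).
[cite: GolubVanLoan2013, §4.8.6 eq. (4.8.15)] -/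
private theorem sinVec_dstAngle_eq_pathMode (j : Fin N) :
    sinVec N (dstAngle N j) = pathMode N j := by
  have hθ : dstAngle N j = pathAngle N j := by
    unfold dstAngle pathAngle
    norm_cast
  funext i
  rw [hθ]
  simp only [sinVec, pathMode]
  norm_cast

/-- `Δ_DD s(θ_j) = 4 sin²(θ_j/2) s(θ_j)`, `θ_j = (j+1)π/(N+1)` (the public statement is
`laplaceDD_mulVec_pathMode` of `QTTLaplaceSpectrum.lean`).
[cite: GolubVanLoan2013, §4.8.6 (the Dirichlet–Dirichlet matrix)] -/
private theorem laplaceDD_mulVec_pathMode_aux (j : Fin N) :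
    laplaceDD ℝ N *ᵥ pathMode N j = (4 * Real.sin (pathAngle N j / 2) ^ 2) • pathMode N j := by
  have hθ : dstAngle N j = pathAngle N j := by
    unfold dstAngle pathAngle
    norm_cast
  rw [laplaceDD_eq_dirichletT_aux, ← sinVec_dstAngle_eq_pathMode, ← hθ]
  exact dirichletT_mulVec_dstVec N j

/-- `0 < 4 sin²(θ_j/2)`. [cite: GolubVanLoan2013, §4.8.6 (the Dirichlet–Dirichlet matrix)] -/
private theorem ddEig_pos_aux (j : Fin N) : 0 < 4 * Real.sin (pathAngle N j / 2) ^ 2 := by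
  have h1 : 0 < pathAngle N j / 2 := by have := pathAngle_pos (n := N) j; linarith
  have h2 : pathAngle N j / 2 < π := by have := pathAngle_lt_pi (n := N) j; linarith
  have hs : 0 < Real.sin (pathAngle N j / 2) := Real.sin_pos_of_pos_of_lt_pi h1 h2
  positivity

/-- Matrix form `Δ_DD S = S diag(4 sin²(θ_j/2))`, `S = DST(N)` (the public statement is
`laplaceDD_mul_sineMatrix` of `QTTLaplaceSpectrum.lean`).
[cite: GolubVanLoan2013, §4.8.6 (the Dirichlet–Dirichlet matrix)] -/
private theorem laplaceDD_mul_sineMatrix_aux :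
    laplaceDD ℝ N * sineMatrix N =
      sineMatrix N * diagonal fun j => 4 * Real.sin (pathAngle N j / 2) ^ 2 := by
  ext i j
  rw [mul_diagonal, mul_apply']
  have h := congr_fun (laplaceDD_mulVec_pathMode_aux (N := N) j) i
  rw [mulVec, Pi.smul_apply, smul_eq_mul] at h
  have hc : (fun k => sineMatrix N k j) = pathMode N j := by
    funext k
    rfl
  rw [hc, h, mul_comm]
  rfl

/-- **Eigenvectors of the `D`-dimensional model problem**: for every multi-index `j`,
`Δ^{(D)}_{DD} (⊗_k s(θ_{j_k})) = (Σ_k a_k λ_{j_k}) · ⊗_k s(θ_{j_k})` — products of sines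
`∏_k sin((i_k+1)θ_{j_k})`, eigenvalues `Σ_k a_k · 4 sin²(θ_{j_k}/2)`, `θ_j = (j+1)π/(N+1)`.
[cite: GolubVanLoan2013, §4.8.4 eqs. (4.8.12)–(4.8.14) and §4.8.6]
[cite: LynchRiceThomas1964, §2 eq. (2.5)] -/
theorem laplaceMultiDD_mulVec_tensorPi_pathMode (a : Fin D → ℝ) (j : Fin D → Fin N) :
    laplaceMulti a (fun _ : Fin D => laplaceDD ℝ N) *ᵥ tensorPi (fun k => pathMode N (j k)) =
      (∑ k, a k * (4 * Real.sin (pathAngle N (j k) / 2) ^ 2)) •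
        tensorPi (fun k => pathMode N (j k)) :=
  laplaceMulti_mulVec_tensorPi_of_eigvec a (μ := fun k => 4 * Real.sin (pathAngle N (j k) / 2) ^ 2)
    fun k => laplaceDD_mulVec_pathMode_aux (j k)

/-- Matrix form: `Δ^{(D)}_{DD} (⊗_k S) = (⊗_k S) diag(j ↦ Σ_k a_k λ_{j_k})`, `S = DST(N)`.
[cite: GolubVanLoan2013, §4.8.4 eqs. (4.8.13)–(4.8.14) and §4.8.6] -/
theorem laplaceMultiDD_mul_kronPi_sineMatrix (a : Fin D → ℝ) :
    laplaceMulti a (fun _ : Fin D => laplaceDD ℝ N) * kronPi (fun _ : Fin D => sineMatrix N) =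
      kronPi (fun _ : Fin D => sineMatrix N) *
        diagonal fun j => ∑ k, a k * (4 * Real.sin (pathAngle N (j k) / 2) ^ 2) :=
  laplaceMulti_mul_kronPi a (μ := fun _ j => 4 * Real.sin (pathAngle N j / 2) ^ 2)
    fun _ => laplaceDD_mul_sineMatrix_aux

/-- `⊗_k S` is invertible. [cite: GolubVanLoan2013, §4.8.6 (the Dirichlet–Dirichlet matrix)] -/
theorem isUnit_det_kronPi_sineMatrix : IsUnit (kronPi fun _ : Fin D => sineMatrix N).det := by
  classical
  exact isUnit_det_kronPi fun _ => isUnit_det_sineMatrix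

/-- `(⊗_k S)⁻¹ = (2/(N+1))^D · ⊗_k Sᵀ` (`S⁻¹ = (2/(N+1)) Sᵀ` in every factor; 'for self-adjoint
problems, `P` and `Q` are real orthogonal matrices so that `P⁻¹ = Pᵀ`, `Q⁻¹ = Qᵀ`' up to scale).
[cite: GolubVanLoan2013, §4.8.6 (the Dirichlet–Dirichlet matrix, `V⁻¹ = (2/(m+1))V`)]
[cite: LynchRiceThomas1964, §2 (p. 380)] -/
theorem kronPi_sineMatrix_inv :
    (kronPi fun _ : Fin D => sineMatrix N)⁻¹ =
      (2 / ((N + 1 : ℕ) : ℝ)) ^ D • kronPi fun _ : Fin D => (sineMatrix N)ᵀ := by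
  classical
  rw [kronPi_inv fun _ => isUnit_det_sineMatrix]
  simp_rw [sineMatrix_inv]
  rw [kronPi_smul, Finset.prod_const, Finset.card_univ, Fintype.card_fin]

/-- Similarity form: `Δ^{(D)}_{DD} = (2/(N+1))^D · (⊗S) diag(j ↦ Σ_k a_k λ_{j_k}) (⊗Sᵀ)`.
[cite: GolubVanLoan2013, §4.8.4 eqs. (4.8.13)–(4.8.14) and §4.8.6] -/
theorem laplaceMultiDD_eq_sine_conj (a : Fin D → ℝ) :
    laplaceMulti a (fun _ : Fin D => laplaceDD ℝ N) =
      (2 / ((N + 1 : ℕ) : ℝ)) ^ D •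
        (kronPi (fun _ : Fin D => sineMatrix N) *
          diagonal (fun j => ∑ k, a k * (4 * Real.sin (pathAngle N (j k) / 2) ^ 2)) *
          kronPi fun _ : Fin D => (sineMatrix N)ᵀ) := by
  classical
  rw [laplaceMulti_eq_kronPi_conj a (μ := fun _ j => 4 * Real.sin (pathAngle N j / 2) ^ 2)
      (fun _ => laplaceDD_mul_sineMatrix_aux) fun _ => isUnit_det_sineMatrix,
    kronPi_sineMatrix_inv, Matrix.mul_smul]

/-- **Spectrum of the model problem**: `χ(X) = ∏_j (X − Σ_k a_k · 4 sin²(θ_{j_k}/2))`.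
[cite: GolubVanLoan2013, §4.8.4 eqs. (4.8.13)–(4.8.14) and §4.8.6]
[cite: LynchRiceThomas1964, §2 eqs. (2.5)–(2.6)] -/
theorem charpoly_laplaceMultiDD (a : Fin D → ℝ) :
    (laplaceMulti a (fun _ : Fin D => laplaceDD ℝ N)).charpoly =
      ∏ j : Fin D → Fin N,
        (Polynomial.X - Polynomial.C (∑ k, a k * (4 * Real.sin (pathAngle N (j k) / 2) ^ 2))) := by
  classical
  exact charpoly_laplaceMulti a (μ := fun _ j => 4 * Real.sin (pathAngle N j / 2) ^ 2)
    (fun _ => laplaceDD_mul_sineMatrix_aux) fun _ => isUnit_det_sineMatrix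

/-- `det Δ^{(D)}_{DD} = ∏_j Σ_k a_k λ_{j_k}`.
[cite: GolubVanLoan2013, §4.8.4 eqs. (4.8.13)–(4.8.14) and §4.8.6] -/
theorem det_laplaceMultiDD (a : Fin D → ℝ) :
    (laplaceMulti a (fun _ : Fin D => laplaceDD ℝ N)).det =
      ∏ j : Fin D → Fin N, ∑ k, a k * (4 * Real.sin (pathAngle N (j k) / 2) ^ 2) := by
  classical
  exact det_laplaceMulti a (μ := fun _ j => 4 * Real.sin (pathAngle N j / 2) ^ 2)
    (fun _ => laplaceDD_mul_sineMatrix_aux) fun _ => isUnit_det_sineMatrix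

/-- Positive weights and at least one direction: every eigenvalue `Σ_k a_k λ_{j_k}` is positive
('In our example, all the `λ_i` and `μ_i` are positive'), so the system is nonsingular.
[cite: GolubVanLoan2013, §4.8.4 (after (4.8.14))] -/
theorem laplaceMultiDD_eig_pos (hD : 0 < D) {a : Fin D → ℝ} (ha : ∀ k, 0 < a k)
    (j : Fin D → Fin N) :
    0 < ∑ k, a k * (4 * Real.sin (pathAngle N (j k) / 2) ^ 2) := by
  have hne : (Finset.univ : Finset (Fin D)).Nonempty := ⟨⟨0, hD⟩, Finset.mem_univ _⟩
  exact Finset.sum_pos (fun k _ => mul_pos (ha k) (ddEig_pos_aux (j k))) hne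

/-- **Fast Poisson solver in `D` dimensions, matrix form**:
`(Δ^{(D)}_{DD})⁻¹ = (2/(N+1))^D · (⊗S) diag((Σ_k a_k λ_{j_k})⁻¹) (⊗Sᵀ)`.
[cite: LynchRiceThomas1964, §2 eq. (2.5)]
[cite: GolubVanLoan2013, §4.8.4 Algorithm 4.8.2 and §4.8.6] -/
theorem inv_laplaceMultiDD_eq_sine_conj (hD : 0 < D) {a : Fin D → ℝ} (ha : ∀ k, 0 < a k) :
    (laplaceMulti a (fun _ : Fin D => laplaceDD ℝ N))⁻¹ =
      (2 / ((N + 1 : ℕ) : ℝ)) ^ D •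
        (kronPi (fun _ : Fin D => sineMatrix N) *
          diagonal (fun j => (∑ k, a k * (4 * Real.sin (pathAngle N (j k) / 2) ^ 2))⁻¹) *
          kronPi fun _ : Fin D => (sineMatrix N)ᵀ) := by
  classical
  rw [inv_laplaceMulti_eq_kronPi_conj a (μ := fun _ j => 4 * Real.sin (pathAngle N j / 2) ^ 2)
      (fun _ => laplaceDD_mul_sineMatrix_aux) (fun _ => isUnit_det_sineMatrix)
      fun j => (laplaceMultiDD_eig_pos hD ha j).ne',
    kronPi_sineMatrix_inv, Matrix.mul_smul]

/-- **The discrete Green's function of the box as a `D`-fold sine series**: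
`(Δ^{(D)}_{DD})⁻¹(α, β)
   = (2/(N+1))^D Σ_j (∏_k sin((α_k+1)θ_{j_k}) sin((β_k+1)θ_{j_k})) / (Σ_k a_k 4 sin²(θ_{j_k}/2))`.
[cite: LynchRiceThomas1964, §2 eq. (2.6)] [cite: GolubVanLoan2013, §4.8.4 and §4.8.6] -/
theorem inv_laplaceMultiDD_apply (hD : 0 < D) {a : Fin D → ℝ} (ha : ∀ k, 0 < a k)
    (α β : Fin D → Fin N) :
    (laplaceMulti a (fun _ : Fin D => laplaceDD ℝ N))⁻¹ α β =
      (2 / ((N + 1 : ℕ) : ℝ)) ^ D *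
        ∑ j : Fin D → Fin N,
          (∏ k, pathMode N (j k) (α k) * pathMode N (j k) (β k)) /
            (∑ k, a k * (4 * Real.sin (pathAngle N (j k) / 2) ^ 2)) := by
  rw [inv_laplaceMultiDD_eq_sine_conj hD ha, Matrix.smul_apply, smul_eq_mul, Matrix.mul_apply]
  congr 1
  refine Finset.sum_congr rfl fun j _ => ?_
  rw [mul_diagonal, kronPi_apply, kronPi_apply, div_eq_mul_inv, Finset.prod_mul_distrib]
  simp only [sineMatrix, transpose_apply, Matrix.of_apply]
  ring

end Dirichlet

end Literature.LinearAlgebra.TensorNetworks
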